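import Literature.NumberTheory.Transcendental.ExpOneTranscendenceMeasureMatrix
import HarnessLib

/-!
# Waldschmidt 1978, Corollary 3.9 (transcendence measure for `e^β`) — proofs, part II:
# the interpolation matrix for `z^τ e^{tβz}` at the integers

Sibling PROOFS file of `ExpAlgebraicTranscendenceMeasure.lean` (the named fact
`Literature.NumberTheory.Transcendental.Waldschmidt1978_cor_3_9`). Everything here is PROVED; no
definitions, no named facts. Throughout, `qcoef(σ,τ,s,t,k)` abbreviates (in the docstrings only) the
integer `C(σ,k) τ(τ-1)⋯(τ-k+1) s^{τ-k} t^{σ-k}`, the coefficient of `β^{σ-k}` in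
`e^{-tβs} (d/dz)^σ (z^τ e^{tβz})|_{z=s}`; in the statements it is written out as
`(σ.choose k : ℤ) * (τ.descFactorial k : ℤ) * s ^ (τ - k) * t ^ (σ - k)`.

This is step a) of [NesterenkoWaldschmidt1996, §6] for `θ = β` (`β ≠ 0` algebraic, the case of
the approximation measure of `e^β`, Theorem 3.8 of [Waldschmidt1978]) with the monomial basis
`f_{τ,t}(z) = z^τ e^{tβz}` (`0 ≤ τ ≤ T`, `|t| ≤ T₁`) in place of the binomial polynomials — the
generalisation to `β ≠ 1` of the tree's `ExpOneTranscendenceMeasureMatrix.lean` (`θ = β = 1`):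

* `(d/dz)^σ f_{τ,t}(s) = (∑ₖ qcoef(σ,τ,s,t,k) β^{σ-k}) · (e^β)^{ts}`
  (`Waldschmidt1978.iteratedDeriv_monomialExp_beta`, [NesterenkoWaldschmidt1996, (6.2)]); the
  corresponding algebraic number is `a(σ,s;τ,t) = (∑ₖ qcoef(σ,τ,s,t,k) β^{σ-k}) · ξ^{ts}` ((6.3),
  `e^β` replaced by its algebraic approximation `ξ`);
* `((∂ + βt)^σ X^τ)(s) = ∑ₖ qcoef(σ,τ,s,t,k) β^{σ-k}` (`Waldschmidt1978.eval_twist_pow_X_pow_beta`),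
  whence **Lemma 6** (`Waldschmidt1978.algMatrix_mulVec_eq_zero_beta`): for `β ≠ 0`, `ξ ≠ 0`
  and `(2T₁+1)T < (S+1-2T₁)(2S₁+1)` the matrix `(a)` has linearly independent columns, by the
  multiplicity estimate of part III of the `ExpOne` files (`NW1996.multiplicity_estimate`, which is
  stated over any field with the twists `∂ + wᵢ`, here `wᵢ = βtᵢ`);
* the size estimates of steps b), c): `∑ₖ |qcoef| ≤ S₁^T (T+T₁)^S`
  (`Waldschmidt1978.sum_abs_qcoef_le`), `|f^{(σ)}_{τ,t}(z)| ≤ R^T (T+W)^S e^{WR}` on `|z| ≤ R` for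
  `|tβ| ≤ W` (`Waldschmidt1978.norm_iteratedDeriv_monomialExp_le'`), and the perturbation
  `|ξ^j − w^j| ≤ N B^{3N} |ξ − w|` for `|j| ≤ N` when `ξ^{±1}, w^{±1}` have modulus `≤ B`
  (`Waldschmidt1978.norm_zpow_sub_zpow_le'`);
* the expansion of the determinant of a matrix with entries `(∑ₖ p_{ijk} β^{d_{ik}}) ξ^{e_{ij}}`
  as an integer combination `∑_l a_l β^{e₁ l} ξ^{e₂ l}` of monomials in `(β, ξ)`, with the bound
  `∑ |a_l| ≤ L! 𝔓^L` for its length (`Waldschmidt1978.det_expand`, `Waldschmidt1978.sum_abs_detCoeff_le`),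
  which is the input of Liouville's inequality in two algebraic numbers (part I).

## References

* [NesterenkoWaldschmidt1996] Yu. V. Nesterenko, M. Waldschmidt, Mat. Zapiski 2 (1996) 23–42
  (arXiv:math/0002047), §6 a), (6.2), (6.3), Lemma 6.
* [Waldschmidt1978] M. Waldschmidt, J. Austral. Math. Soc. (A) 25 (1978) 445–465, Theorem 3.8.
-/

noncomputable section

open Polynomial Finset Complex Matrix

namespace Literature.NumberTheory.Transcendental

namespace Waldschmidt1978

open NW1996

/-! ### The integer coefficients -/

/-- `qcoef(σ,τ,s,t,k) = C(σ,k) τ(τ-1)⋯(τ-k+1) s^{τ-k} t^{σ-k}` vanishes for `k > σ`. [folklore] -/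
theorem qcoef_eq_zero_of_lt {σ : ℕ} (τ : ℕ) (s t : ℤ) {k : ℕ} (hk : σ < k) :
    (σ.choose k : ℤ) * (τ.descFactorial k : ℤ) * s ^ (τ - k) * t ^ (σ - k) = 0 := by
  simp [Nat.choose_eq_zero_of_lt hk]

/-- Extending the range of summation: for `σ ≤ S`,
`∑_{k ≤ S} qcoef(σ,τ,s,t,k) g(k) = ∑_{k ≤ σ} qcoef(σ,τ,s,t,k) g(k)`. [folklore] -/
theorem sum_range_qcoef_mul_eq {R : Type*} [CommRing R] {σ S : ℕ} (hσ : σ ≤ S) (τ : ℕ) (s t : ℤ)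
    (g : ℕ → R) :
    ∑ k ∈ range (S + 1), (((σ.choose k : ℤ) * (τ.descFactorial k : ℤ) * s ^ (τ - k) * t ^ (σ - k) : ℤ) : R) * g k =
      ∑ k ∈ range (σ + 1), (((σ.choose k : ℤ) * (τ.descFactorial k : ℤ) * s ^ (τ - k) * t ^ (σ - k) : ℤ) : R) * g k := by
  symm
  refine Finset.sum_subset (Finset.range_subset_range.mpr (by omega)) fun k hkS hkσ => ?_
  have hk : σ < k := by
    simp only [Finset.mem_range, not_lt] at hkσ ⊢; omega
  rw [qcoef_eq_zero_of_lt τ s t hk, Int.cast_zero, zero_mul]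

/-! ### The twisted derivative `(∂ + w)^σ X^τ` -/

/-- `((∂ + w)^σ X^τ)(s) = ∑ₖ C(σ,k) τ(τ-1)⋯(τ-k+1) s^{τ-k} w^{σ-k}` over any field.
[cite: NesterenkoWaldschmidt1996, §6 Lemma 6] -/
theorem eval_twist_pow_X_pow' {K : Type*} [Field K] (w s : K) (σ τ : ℕ) :
    ((twist w ^ σ) (X ^ τ : K[X])).eval s =
      ∑ k ∈ range (σ + 1), (σ.choose k : K) * (τ.descFactorial k : K) * s ^ (τ - k) * w ^ (σ - k) := by
  have h := twist_pow_mul w (X ^ τ : K[X]) 1 σ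
  rw [mul_one] at h
  rw [h, eval_finsetSum, Finset.Nat.sum_antidiagonal_eq_sum_range_succ_mk]
  refine Finset.sum_congr rfl fun k _ => ?_
  rw [iterate_derivative_X_pow_eq_smul, twist_pow_one, eval_smul, eval_mul, eval_smul, eval_pow,
    eval_X, eval_C, nsmul_eq_mul, smul_eq_mul]
  ring

/-- At `w = βt`, `s ∈ ℤ`: `((∂ + βt)^σ X^τ)(s) = ∑ₖ qcoef(σ,τ,s,t,k) β^{σ-k}` (the action of `δ^σ`,
`δ = ∂/∂X + βY∂/∂Y`, on `X^τ Y^t` at `(s, ·)`). [cite: NesterenkoWaldschmidt1996, §6 Lemma 6] -/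
theorem eval_twist_pow_X_pow_beta (β : ℂ) (σ τ : ℕ) (s t : ℤ) :
    ((twist (β * (t : ℂ)) ^ σ) (X ^ τ : ℂ[X])).eval (s : ℂ) =
      ∑ k ∈ range (σ + 1),
        (((σ.choose k : ℤ) * (τ.descFactorial k : ℤ) * s ^ (τ - k) * t ^ (σ - k) : ℤ) : ℂ) * β ^ (σ - k) := by
  rw [eval_twist_pow_X_pow']
  refine Finset.sum_congr rfl fun k _ => ?_
  push_cast; ring

/-! ### Lemma 6 for `θ = β`: full column rank -/

/-- **Lemma 6** ([NesterenkoWaldschmidt1996, §6 a)]) for `θ = β` and the functions `z^τ e^{tβz}`: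
if `β ≠ 0`, `ξ ≠ 0`, `2T₁ ≤ S + 1` and `(2T₁+1)T < (S+1-2T₁)(2S₁+1)` (condition (2.1) with `D₀ = T`,
`D₁ = 2T₁`, `M = 2S₁+1`, `S ← S+1`), then the matrix
`a(σ,s;τ,t) = (∑ₖ qcoef(σ,τ,s,t,k) β^{σ-k}) ξ^{ts}` (rows `0 ≤ σ ≤ S`, `|s| ≤ S₁`; columns `0 ≤ τ ≤ T`,
`|t| ≤ T₁`) has linearly independent columns: a relation `∑ c_{τ,t} a(σ,s;τ,t) = 0` says that
`R = ∑ c_{τ,t} X^τ Y^t` has `δ^σ R (s, ξ^s) = 0` for all `σ ≤ S`, `|s| ≤ S₁`, contradicting the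
multiplicity estimate (`NW1996.multiplicity_estimate`, twists `∂ + βt`, `βt` pairwise distinct as
`β ≠ 0`). [cite: NesterenkoWaldschmidt1996, §6 Lemma 6] -/
theorem algMatrix_mulVec_eq_zero_beta {β ξ : ℂ} (hβ : β ≠ 0) (hξ : ξ ≠ 0) {T T₁ S S₁ : ℕ}
    (h2T₁ : 2 * T₁ ≤ S + 1) (hcount : (2 * T₁ + 1) * T < (S + 1 - 2 * T₁) * (2 * S₁ + 1))
    (c : Fin (T + 1) × Fin (2 * T₁ + 1) → ℂ)
    (hc : (Matrix.of fun (ω : Fin (S + 1) × Fin (2 * S₁ + 1)) (μ : Fin (T + 1) × Fin (2 * T₁ + 1)) =>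
        (∑ k ∈ range ((ω.1 : ℕ) + 1),
            ((((ω.1 : ℕ).choose k : ℤ) * ((μ.1 : ℕ).descFactorial k : ℤ) *
                (((ω.2 : ℕ) : ℤ) - S₁) ^ ((μ.1 : ℕ) - k) * (((μ.2 : ℕ) : ℤ) - T₁) ^ ((ω.1 : ℕ) - k) : ℤ) : ℂ) *
              β ^ ((ω.1 : ℕ) - k)) *
          ξ ^ (((μ.2 : ℤ) - T₁) * ((ω.2 : ℤ) - S₁))) *ᵥ c = 0) :
    c = 0 := by
  classical
  by_contra hc0
  -- the data of the multiplicity estimate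
  set Q : Fin (2 * T₁ + 1) → ℂ[X] := fun b => ∑ a : Fin (T + 1), C (c (a, b)) * X ^ (a : ℕ) with hQ
  set w : Fin (2 * T₁ + 1) → ℂ := fun b => β * ((((b : ℤ) - T₁ : ℤ) : ℂ)) with hw
  set pt : Fin (2 * S₁ + 1) → ℂ := fun d => (((d : ℤ) - S₁ : ℤ) : ℂ) with hpt
  set y : Fin (2 * S₁ + 1) → Fin (2 * T₁ + 1) → ℂ :=
    fun d b => ξ ^ (((b : ℤ) - T₁) * ((d : ℤ) - S₁)) with hy
  have hw_inj : Function.Injective w := by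
    intro b b' h
    simp only [hw] at h
    have h0 := mul_left_cancel₀ hβ h
    have h' : ((b : ℕ) : ℤ) - T₁ = ((b' : ℕ) : ℤ) - T₁ := by exact_mod_cast h0
    exact Fin.ext (by exact_mod_cast sub_left_inj.mp h')
  have hpt_inj : Function.Injective pt := by
    intro d d' h
    simp only [hpt] at h
    have h' : ((d : ℕ) : ℤ) - S₁ = ((d' : ℕ) : ℤ) - S₁ := by exact_mod_cast h
    exact Fin.ext (by exact_mod_cast sub_left_inj.mp h')
  have hQne : ∃ b, Q b ≠ 0 := by
    by_contra hall
    push Not at hall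
    apply hc0
    funext ab
    obtain ⟨a, b⟩ := ab
    have h := congrArg (fun P : ℂ[X] => P.coeff (a : ℕ)) (hall b)
    simp only [hQ, finsetSum_coeff, coeff_C_mul_X_pow, coeff_zero, Fin.val_inj] at h
    rw [Finset.sum_ite_eq] at h
    simpa using h
  have hdeg : ∀ b, (Q b).natDegree ≤ T := by
    intro b
    refine natDegree_sum_le_of_forall_le _ _ fun a _ => (natDegree_C_mul_X_pow_le _ _).trans ?_
    have := a.isLt; omega
  have hy_ne : ∀ d b, y d b ≠ 0 := fun d b => zpow_ne_zero _ hξ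
  -- the vanishing: `∑_b ((∂ + w_b)^σ Q_b)(s_d) y_{d,b} = (A c)_{(σ,d)} = 0`
  have hvanish : ∀ d, ∀ σ < S + 1,
      ∑ b, ((twist (w b) ^ σ) (Q b)).eval (pt d) * y d b = 0 := by
    intro d σ hσ
    have key : ∀ b, ((twist (w b) ^ σ) (Q b)).eval (pt d) =
        ∑ a : Fin (T + 1), c (a, b) *
          ∑ k ∈ range (σ + 1), (((σ.choose k : ℤ) * ((a : ℕ).descFactorial k : ℤ) *
            (((d : ℕ) : ℤ) - S₁) ^ ((a : ℕ) - k) * (((b : ℕ) : ℤ) - T₁) ^ (σ - k) : ℤ) : ℂ) * β ^ (σ - k) := by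
      intro b
      simp only [hQ, map_sum, eval_finsetSum]
      refine Finset.sum_congr rfl fun a _ => ?_
      rw [C_mul', map_smul, eval_smul, smul_eq_mul, hw, hpt, eval_twist_pow_X_pow_beta]
    have h := congrFun hc (⟨σ, hσ⟩, d)
    simp only [Matrix.mulVec, dotProduct, Matrix.of_apply, Pi.zero_apply, Fintype.sum_prod_type] at h
    rw [Finset.sum_comm] at h
    rw [← h]
    refine Finset.sum_congr rfl fun b _ => ?_
    rw [key, Finset.sum_mul]
    refine Finset.sum_congr rfl fun a _ => ?_
    simp only [hy]
    ring
  have hmult := multiplicity_estimate w hw_inj Q hQne hdeg pt hpt_inj y hy_ne hvanish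
  simp only [Fintype.card_fin] at hmult
  -- the count
  have h1 : (2 * T₁ + 1 - 1) * (2 * S₁ + 1) = 2 * T₁ * (2 * S₁ + 1) := by
    rw [Nat.add_sub_cancel]
  rw [h1] at hmult
  have hsplit : (S + 1) * (2 * S₁ + 1) = (S + 1 - 2 * T₁) * (2 * S₁ + 1) + 2 * T₁ * (2 * S₁ + 1) := by
    rw [← Nat.add_mul, Nat.sub_add_cancel h2T₁]
  have := Nat.add_lt_add_right hcount (2 * T₁ * (2 * S₁ + 1))
  omega

/-! ### The functions `z^τ e^{tβz}` -/

/-- **The derivatives of `z^τ e^{tβz}` at an integer** ([NesterenkoWaldschmidt1996, (6.2)] with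
`Δ(z,τ,1) = z^τ`, `θ = β`): `(d/dz)^σ (z^τ e^{tβz})|_{z=s} = (∑ₖ qcoef(σ,τ,s,t,k) β^{σ-k}) · (e^β)^{ts}`.
[cite: NesterenkoWaldschmidt1996, §6 (6.2)] -/
theorem iteratedDeriv_monomialExp_beta (β : ℂ) (σ τ : ℕ) (s t : ℤ) :
    iteratedDeriv σ (fun z : ℂ => z ^ τ * cexp ((t : ℂ) * β * z)) (s : ℂ) =
      (∑ k ∈ range (σ + 1),
        (((σ.choose k : ℤ) * (τ.descFactorial k : ℤ) * s ^ (τ - k) * t ^ (σ - k) : ℤ) : ℂ) * β ^ (σ - k)) *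
        cexp β ^ (t * s) := by
  rw [iteratedDeriv_monomialExp σ τ ((t : ℂ) * β) (s : ℂ)]
  have hexp : cexp ((t : ℂ) * β * (s : ℂ)) = cexp β ^ (t * s) := by
    rw [← Complex.exp_int_mul]; push_cast; ring_nf
  rw [Finset.sum_mul]
  refine Finset.sum_congr rfl fun k _ => ?_
  rw [hexp]
  push_cast; ring

/-- **The bound on the discs** ([NesterenkoWaldschmidt1996, §6 b)], complex frequency): for
`σ ≤ S`, `τ ≤ T`, `‖c‖ ≤ W`, `1 ≤ W`, `1 ≤ R` and `|z| ≤ R`: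
`|(d/dz)^σ (z^τ e^{cz})| ≤ R^T (T+W)^S e^{W R}`. [cite: NesterenkoWaldschmidt1996, §6 b)] -/
theorem norm_iteratedDeriv_monomialExp_le' {σ τ S T : ℕ} {c : ℂ} {W : ℝ} (hσ : σ ≤ S) (hτ : τ ≤ T)
    (hW : 1 ≤ W) (hc : ‖c‖ ≤ W) {R : ℝ} (hR : 1 ≤ R) {z : ℂ} (hz : ‖z‖ ≤ R) :
    ‖iteratedDeriv σ (fun z : ℂ => z ^ τ * cexp (c * z)) z‖ ≤
      R ^ T * ((T : ℝ) + W) ^ S * Real.exp (W * R) := by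
  have hR0 : 0 ≤ R := by linarith
  have hW0 : 0 ≤ W := by linarith
  rw [iteratedDeriv_monomialExp]
  refine (norm_sum_le _ _).trans ?_
  have hexp : ‖cexp (c * z)‖ ≤ Real.exp (W * R) := by
    refine (Complex.norm_exp_le_exp_norm _).trans ?_
    rw [Real.exp_le_exp, norm_mul]
    exact mul_le_mul hc hz (norm_nonneg _) hW0
  calc ∑ k ∈ range (σ + 1), ‖(σ.choose k : ℂ) * ((τ.descFactorial k : ℂ) * z ^ (τ - k)) *
          (c ^ (σ - k) * cexp (c * z))‖
      ≤ ∑ k ∈ range (σ + 1), (T : ℝ) ^ k * W ^ (σ - k) * (σ.choose k : ℝ) *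
          (R ^ T * Real.exp (W * R)) := by
        refine Finset.sum_le_sum fun k _ => ?_
        rw [norm_mul, norm_mul, norm_mul, norm_mul, norm_pow, norm_pow, Complex.norm_natCast,
          Complex.norm_natCast]
        have h1 : (τ.descFactorial k : ℝ) ≤ (T : ℝ) ^ k := by
          calc (τ.descFactorial k : ℝ) ≤ (τ : ℝ) ^ k := by exact_mod_cast Nat.descFactorial_le_pow τ k
            _ ≤ (T : ℝ) ^ k := pow_le_pow_left₀ (Nat.cast_nonneg _) (by exact_mod_cast hτ) k
        have h2 : ‖z‖ ^ (τ - k) ≤ R ^ T :=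
          (pow_le_pow_left₀ (norm_nonneg _) hz _).trans
            (pow_le_pow_right₀ hR ((Nat.sub_le _ _).trans hτ))
        have h3 : ‖c‖ ^ (σ - k) ≤ W ^ (σ - k) := pow_le_pow_left₀ (norm_nonneg _) hc _
        calc (σ.choose k : ℝ) * ((τ.descFactorial k : ℝ) * ‖z‖ ^ (τ - k)) *
              (‖c‖ ^ (σ - k) * ‖cexp (c * z)‖)
            ≤ (σ.choose k : ℝ) * ((T : ℝ) ^ k * R ^ T) * (W ^ (σ - k) * Real.exp (W * R)) := by
              gcongr
          _ = (T : ℝ) ^ k * W ^ (σ - k) * (σ.choose k : ℝ) * (R ^ T * Real.exp (W * R)) := by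
              ring
    _ = ((T : ℝ) + W) ^ σ * (R ^ T * Real.exp (W * R)) := by rw [← Finset.sum_mul, add_pow]
    _ ≤ ((T : ℝ) + W) ^ S * (R ^ T * Real.exp (W * R)) := by
        have hTT : (1 : ℝ) ≤ (T : ℝ) + W := by linarith [(Nat.cast_nonneg T : (0 : ℝ) ≤ T)]
        gcongr
    _ = R ^ T * ((T : ℝ) + W) ^ S * Real.exp (W * R) := by ring

/-! ### Sizes of the coefficients -/

/-- `∑ₖ |qcoef(σ,τ,s,t,k)| ≤ S₁^T (T + T₁)^S` for `|s| ≤ S₁`, `|t| ≤ T₁`, `τ ≤ T`, `σ ≤ S`, `S₁ ≥ 1`,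
`T₁ ≥ 1` (the length of the polynomial `∑ₖ qcoef · X^{σ-k}`; [NesterenkoWaldschmidt1996, §6 c)]).
[cite: NesterenkoWaldschmidt1996, §6 c)] -/
theorem sum_abs_qcoef_le {σ τ S T S₁ T₁ : ℕ} {s t : ℤ} (hσ : σ ≤ S) (hτ : τ ≤ T) (hS₁ : 1 ≤ S₁)
    (hT₁ : 1 ≤ T₁) (hs : |s| ≤ S₁) (ht : |t| ≤ T₁) :
    ∑ k ∈ range (σ + 1), |(((σ.choose k : ℤ) * (τ.descFactorial k : ℤ) * s ^ (τ - k) * t ^ (σ - k) : ℤ) : ℝ)| ≤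
      (S₁ : ℝ) ^ T * ((T : ℝ) + T₁) ^ S := by
  have hS₁r : (1 : ℝ) ≤ S₁ := by exact_mod_cast hS₁
  have hsr : |(s : ℝ)| ≤ S₁ := by rw [← Int.cast_abs]; exact_mod_cast hs
  have htr : |(t : ℝ)| ≤ T₁ := by rw [← Int.cast_abs]; exact_mod_cast ht
  calc ∑ k ∈ range (σ + 1), |(((σ.choose k : ℤ) * (τ.descFactorial k : ℤ) * s ^ (τ - k) * t ^ (σ - k) : ℤ) : ℝ)|
      = ∑ k ∈ range (σ + 1), |(σ.choose k : ℝ) * (τ.descFactorial k : ℝ) * (s : ℝ) ^ (τ - k) *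
          (t : ℝ) ^ (σ - k)| := by
        refine Finset.sum_congr rfl fun k _ => ?_
        push_cast; ring_nf
    _ ≤ ∑ k ∈ range (σ + 1), (T : ℝ) ^ k * (T₁ : ℝ) ^ (σ - k) * (σ.choose k : ℝ) * (S₁ : ℝ) ^ τ := by
        refine Finset.sum_le_sum fun k _ => ?_
        rw [abs_mul, abs_mul, abs_mul, abs_pow, abs_pow, Nat.abs_cast, Nat.abs_cast]
        have h1 : (τ.descFactorial k : ℝ) ≤ (T : ℝ) ^ k := by
          calc (τ.descFactorial k : ℝ) ≤ (τ : ℝ) ^ k := by exact_mod_cast Nat.descFactorial_le_pow τ k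
            _ ≤ (T : ℝ) ^ k := pow_le_pow_left₀ (Nat.cast_nonneg _) (by exact_mod_cast hτ) k
        have h2 : |(s : ℝ)| ^ (τ - k) ≤ (S₁ : ℝ) ^ τ :=
          (pow_le_pow_left₀ (abs_nonneg _) hsr _).trans (pow_le_pow_right₀ hS₁r (Nat.sub_le _ _))
        have h3 : |(t : ℝ)| ^ (σ - k) ≤ (T₁ : ℝ) ^ (σ - k) := pow_le_pow_left₀ (abs_nonneg _) htr _
        calc (σ.choose k : ℝ) * (τ.descFactorial k : ℝ) * |(s : ℝ)| ^ (τ - k) * |(t : ℝ)| ^ (σ - k)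
            ≤ (σ.choose k : ℝ) * (T : ℝ) ^ k * (S₁ : ℝ) ^ τ * (T₁ : ℝ) ^ (σ - k) := by
              gcongr
          _ = (T : ℝ) ^ k * (T₁ : ℝ) ^ (σ - k) * (σ.choose k : ℝ) * (S₁ : ℝ) ^ τ := by ring
    _ = ((T : ℝ) + T₁) ^ σ * (S₁ : ℝ) ^ τ := by rw [← Finset.sum_mul, add_pow]
    _ ≤ ((T : ℝ) + T₁) ^ S * (S₁ : ℝ) ^ T := by
        have hTT : (1 : ℝ) ≤ (T : ℝ) + T₁ := by
          have : (1 : ℝ) ≤ T₁ := by exact_mod_cast hT₁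
          linarith [(Nat.cast_nonneg T : (0 : ℝ) ≤ T)]
        gcongr
    _ = (S₁ : ℝ) ^ T * ((T : ℝ) + T₁) ^ S := mul_comm _ _

/-- The modulus of the `β`-polynomial: `|∑ₖ qcoef(σ,τ,s,t,k) β^{σ-k}| ≤ S₁^T (T+T₁)^S max(1,|β|)^S`.
[cite: NesterenkoWaldschmidt1996, §6 b)] -/
theorem norm_sum_qcoef_mul_pow_le {σ τ S T S₁ T₁ : ℕ} {s t : ℤ} (hσ : σ ≤ S) (hτ : τ ≤ T)
    (hS₁ : 1 ≤ S₁) (hT₁ : 1 ≤ T₁) (hs : |s| ≤ S₁) (ht : |t| ≤ T₁) (β : ℂ) :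
    ‖∑ k ∈ range (σ + 1),
        (((σ.choose k : ℤ) * (τ.descFactorial k : ℤ) * s ^ (τ - k) * t ^ (σ - k) : ℤ) : ℂ) * β ^ (σ - k)‖ ≤
      (S₁ : ℝ) ^ T * ((T : ℝ) + T₁) ^ S * max 1 ‖β‖ ^ S := by
  refine (norm_sum_le _ _).trans ?_
  have hB : ∀ k ∈ range (σ + 1),
      ‖(((σ.choose k : ℤ) * (τ.descFactorial k : ℤ) * s ^ (τ - k) * t ^ (σ - k) : ℤ) : ℂ) * β ^ (σ - k)‖ ≤
      |(((σ.choose k : ℤ) * (τ.descFactorial k : ℤ) * s ^ (τ - k) * t ^ (σ - k) : ℤ) : ℝ)| * max 1 ‖β‖ ^ S := by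
    intro k _
    rw [norm_mul, norm_pow, Complex.norm_intCast]
    refine mul_le_mul_of_nonneg_left ?_ (abs_nonneg _)
    exact (pow_le_pow_left₀ (norm_nonneg _) (le_max_right _ _) _).trans
      (pow_le_pow_right₀ (le_max_left _ _) ((Nat.sub_le _ _).trans hσ))
  refine (Finset.sum_le_sum hB).trans ?_
  rw [← Finset.sum_mul]
  exact mul_le_mul_of_nonneg_right (sum_abs_qcoef_le hσ hτ hS₁ hT₁ hs ht) (by positivity)

/-! ### The perturbation `ξ^j - w^j` -/

/-- **The perturbation** ([NesterenkoWaldschmidt1996, §6 b)], `|β^k α^ℓ - θ^k e^{θℓ}|` for `θ = β`):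
if `|a|, |b|, |a|⁻¹, |b|⁻¹ ≤ B` (`B ≥ 1`) then `|a^j - b^j| ≤ N B^{3N} |a - b|` for all integers
`|j| ≤ N`. [cite: NesterenkoWaldschmidt1996, §6 b)] -/
theorem norm_zpow_sub_zpow_le' {a b : ℂ} {B : ℝ} (hB : 1 ≤ B) (ha : ‖a‖ ≤ B) (hb : ‖b‖ ≤ B)
    (ha0 : a ≠ 0) (hb0 : b ≠ 0) (ha' : ‖a‖⁻¹ ≤ B) (hb' : ‖b‖⁻¹ ≤ B) {N : ℕ} {j : ℤ}
    (hj : |j| ≤ N) :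
    ‖a ^ j - b ^ j‖ ≤ N * B ^ (3 * N) * ‖a - b‖ := by
  have hB0 : 0 ≤ B := by linarith
  -- `|a^n - b^n| ≤ n B^n |a - b|`
  have key : ∀ n : ℕ, ‖a ^ n - b ^ n‖ ≤ n * B ^ n * ‖a - b‖ := by
    intro n
    induction n with
    | zero => simp
    | succ n ih =>
      have h : a ^ (n + 1) - b ^ (n + 1) = a * (a ^ n - b ^ n) + (a - b) * b ^ n := by ring
      rw [h]
      calc ‖a * (a ^ n - b ^ n) + (a - b) * b ^ n‖
          ≤ ‖a‖ * ‖a ^ n - b ^ n‖ + ‖a - b‖ * ‖b‖ ^ n := by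
            refine (norm_add_le _ _).trans ?_
            rw [norm_mul, norm_mul, norm_pow]
        _ ≤ B * (n * B ^ n * ‖a - b‖) + ‖a - b‖ * B ^ n := by gcongr
        _ ≤ ((n + 1 : ℕ) : ℝ) * B ^ (n + 1) * ‖a - b‖ := by
            push_cast
            rw [pow_succ]
            have h4 : (0 : ℝ) ≤ B ^ n * ‖a - b‖ := by positivity
            have h5 : B ^ n * ‖a - b‖ ≤ B ^ n * B * ‖a - b‖ := by
              have : B ^ n ≤ B ^ n * B := le_mul_of_one_le_right (by positivity) hB
              exact mul_le_mul_of_nonneg_right this (norm_nonneg _)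
            nlinarith [mul_nonneg (Nat.cast_nonneg n) h4]
  have hmono : ∀ n : ℕ, n ≤ N → (n : ℝ) * B ^ (3 * n) * ‖a - b‖ ≤ N * B ^ (3 * N) * ‖a - b‖ := by
    intro n hn
    have h1 : (n : ℝ) ≤ N := by exact_mod_cast hn
    have h2 : B ^ (3 * n) ≤ B ^ (3 * N) := pow_le_pow_right₀ hB (by omega)
    have : (n : ℝ) * B ^ (3 * n) ≤ N * B ^ (3 * N) := mul_le_mul h1 h2 (by positivity) (by positivity)
    exact mul_le_mul_of_nonneg_right this (norm_nonneg _)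
  have hpow3 : ∀ n : ℕ, (n : ℝ) * B ^ n * ‖a - b‖ ≤ n * B ^ (3 * n) * ‖a - b‖ := by
    intro n
    have : B ^ n ≤ B ^ (3 * n) := pow_le_pow_right₀ hB (by omega)
    gcongr
  rcases Int.eq_nat_or_neg j with ⟨n, rfl | rfl⟩
  · have hn : n ≤ N := by
      have : ((n : ℤ) : ℤ) ≤ N := le_trans (le_abs_self _) hj
      exact_mod_cast this
    rw [zpow_natCast, zpow_natCast]
    exact ((key n).trans (hpow3 n)).trans (hmono n hn)
  · have hn : n ≤ N := by
      have : |(-(n : ℤ))| ≤ N := hj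
      rw [abs_neg] at this
      exact_mod_cast le_trans (le_abs_self _) this
    rw [_root_.zpow_neg, _root_.zpow_neg, zpow_natCast, zpow_natCast,
      inv_sub_inv (pow_ne_zero _ ha0) (pow_ne_zero _ hb0), norm_div, norm_mul, norm_pow, norm_pow]
    have hapos : 0 < ‖a‖ := norm_pos_iff.mpr ha0
    have hbpos : 0 < ‖b‖ := norm_pos_iff.mpr hb0
    have hinv : (‖a‖ ^ n * ‖b‖ ^ n)⁻¹ ≤ B ^ n * B ^ n := by
      rw [mul_inv, ← inv_pow, ← inv_pow]
      exact mul_le_mul (pow_le_pow_left₀ (by positivity) ha' n) (pow_le_pow_left₀ (by positivity) hb' n)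
        (by positivity) (by positivity)
    calc ‖b ^ n - a ^ n‖ / (‖a‖ ^ n * ‖b‖ ^ n)
        = ‖a ^ n - b ^ n‖ * (‖a‖ ^ n * ‖b‖ ^ n)⁻¹ := by rw [norm_sub_rev, div_eq_mul_inv]
      _ ≤ (n * B ^ n * ‖a - b‖) * (B ^ n * B ^ n) :=
          mul_le_mul (key n) hinv (by positivity) (by positivity)
      _ = n * B ^ (3 * n) * ‖a - b‖ := by ring
      _ ≤ N * B ^ (3 * N) * ‖a - b‖ := hmono n hn

/-! ### Expansion of the determinant as a polynomial in `(β, ξ)` -/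

/-- **Expansion of the interpolation determinant.** For a square matrix with entries
`(∑_{k ≤ S} p_{ijk} β^{d_{ik}}) ξ^{e_{ij}}`, its determinant is the integer combination
`∑_{(π,f)} (sign π ∏ⱼ p_{π j, j, f j}) β^{∑ⱼ d_{π j, f j}} ξ^{∑ⱼ e_{π j, j}}` of monomials in `β, ξ`,
the sum running over permutations `π` and maps `f : κ → {0,…,S}`. [folklore] -/
theorem det_expand {κ : Type*} [Fintype κ] [DecidableEq κ] (p : κ → κ → ℕ → ℤ) (d : κ → ℕ → ℕ)
    (e : κ → κ → ℕ) (S : ℕ) (β ξ : ℂ) :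
    (Matrix.of fun i j => (∑ k ∈ range (S + 1), (p i j k : ℂ) * β ^ d i k) * ξ ^ e i j).det =
      ∑ l ∈ (univ : Finset (Equiv.Perm κ)) ×ˢ Fintype.piFinset (fun _ : κ => range (S + 1)),
        ((((Equiv.Perm.sign l.1 : ℤˣ) : ℤ) * ∏ j, p (l.1 j) j (l.2 j) : ℤ) : ℂ) *
          β ^ (∑ j, d (l.1 j) (l.2 j)) * ξ ^ (∑ j, e (l.1 j) j) := by
  rw [Matrix.det_apply', Finset.sum_product]
  refine Finset.sum_congr rfl fun π _ => ?_
  simp only [Matrix.of_apply]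
  -- `∏ⱼ (∑ₖ p β^d) ξ^e = (∏ⱼ ∑ₖ p β^d) · ξ^{∑ e}`
  rw [Finset.prod_mul_distrib, Finset.prod_pow_eq_pow_sum,
    Finset.prod_univ_sum (fun _ : κ => range (S + 1)) (fun j k => (p (π j) j k : ℂ) * β ^ d (π j) k),
    Finset.sum_mul, Finset.mul_sum]
  refine Finset.sum_congr rfl fun f _ => ?_
  rw [Finset.prod_mul_distrib, Finset.prod_pow_eq_pow_sum]
  push_cast
  ring

/-- **The length of the expansion**: if `∑_{k ≤ S} |p_{ijk}| ≤ 𝔓` for all `i, j`, then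
`∑_{(π,f)} |sign π ∏ⱼ p_{π j, j, f j}| ≤ L! · 𝔓^L`, `L = |κ|`. [folklore] -/
theorem sum_abs_detCoeff_le {κ : Type*} [Fintype κ] [DecidableEq κ] (p : κ → κ → ℕ → ℤ) (S : ℕ)
    {𝔓 : ℝ} (hp : ∀ i j, ∑ k ∈ range (S + 1), |(p i j k : ℝ)| ≤ 𝔓) :
    ∑ l ∈ (univ : Finset (Equiv.Perm κ)) ×ˢ Fintype.piFinset (fun _ : κ => range (S + 1)),
        |(((((Equiv.Perm.sign l.1 : ℤˣ) : ℤ) * ∏ j, p (l.1 j) j (l.2 j) : ℤ) : ℝ))| ≤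
      (Fintype.card κ).factorial * 𝔓 ^ Fintype.card κ := by
  rw [Finset.sum_product]
  calc ∑ π : Equiv.Perm κ, ∑ f ∈ Fintype.piFinset (fun _ : κ => range (S + 1)),
          |(((((Equiv.Perm.sign π : ℤˣ) : ℤ) * ∏ j, p (π j) j (f j) : ℤ) : ℝ))|
      = ∑ π : Equiv.Perm κ, ∑ f ∈ Fintype.piFinset (fun _ : κ => range (S + 1)),
          ∏ j, |(p (π j) j (f j) : ℝ)| := by
        refine Finset.sum_congr rfl fun π _ => Finset.sum_congr rfl fun f _ => ?_
        push_cast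
        rw [abs_mul, Finset.abs_prod]
        have : |(((Equiv.Perm.sign π : ℤˣ) : ℤ) : ℝ)| = 1 := by
          rcases Int.units_eq_one_or (Equiv.Perm.sign π) with h | h <;> simp [h]
        rw [this, one_mul]
    _ = ∑ π : Equiv.Perm κ, ∏ j, ∑ k ∈ range (S + 1), |(p (π j) j k : ℝ)| := by
        refine Finset.sum_congr rfl fun π _ => ?_
        rw [Finset.prod_univ_sum]
    _ ≤ ∑ _π : Equiv.Perm κ, ∏ _j : κ, 𝔓 := by
        refine Finset.sum_le_sum fun π _ => ?_
        exact Finset.prod_le_prod (fun j _ => Finset.sum_nonneg fun _ _ => abs_nonneg _)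
          fun j _ => hp (π j) j
    _ = (Fintype.card κ).factorial * 𝔓 ^ Fintype.card κ := by
        rw [Finset.prod_const, Finset.card_univ, Finset.sum_const, Finset.card_univ,
          Fintype.card_perm, nsmul_eq_mul]

end Waldschmidt1978

end Literature.NumberTheory.Transcendental

end
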